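import Literature.NumberTheory.LFunctions.WeilTwoPrimeCellsT120NuSplit
import Literature.NumberTheory.LFunctions.WeilTwoPrimeCellsT120CheckAll
import HarnessLib

/-!
# Level shift of the two-prime minorant moments (higher tail level, same landed moment facts)

The moments `cellsMomentQ₂₃ wL cells q = Σ_j ∫_{cell j} (wL − σ_j(s)) s^q ds` of a two-prime
minorant chain are AFFINE in the level `wL` with slope the power integral of the chain,
`Σ_j (v_j^{q+1} − u_j^{q+1})/(q+1) = (T^{q+1} − s^{q+1})/(q+1)` for a chain from `s` to `T`
(`tl_cellsMomentQ₂₃_level`, `tl_cellsPowInt_of_chain`).  Hence a `WeilCert23` built on the landed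
chain `weilTwoPrimeCellsT120` at ANY level `wL'` (e.g. the sharp tail level `209/100` of
`GroundBartaEvenWinsBeyondArchTwoPrimeTailLevel`, instead of the amplitude level
`weilTwoPrimeCellsT120Level ≈ 1.8455`) passes its moment check `checkNuAt q` from the SAME six
kernel facts `cellsMomentQ₂₃ weilTwoPrimeCellsT120Level Cᵢ q = vᵢ` already in the tree
(`WeilTwoPrimeCellsT120NuFact*`) plus the literal shift `(wL' − wL₁₂₀) · 120^{q+1}/(q+1)`
(**`tl_checkNuAt_of_partsT120_level`**).  No new moment data is needed to raise the complement
level of the deflated certificates on `[0, 120]`.  GroundBarta rung 4 (EvenWinsBeyondArch ≡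
WeilParity ladder), prover A g11.  Pure bookkeeping over `ℚ`; everything is proved.
-/

set_option linter.dupNamespace false

noncomputable section

namespace Summit.RiemannHypothesis.RiemannHypothesis.Theorems.EvenWinsBeyondArch

open Literature.NumberTheory.LFunctions

/-! ## The moments are affine in the level -/

/-- The power integrals of a cell list: `Σ_j (v_j^{q+1} − u_j^{q+1})/(q+1)`. [folklore] -/
def tl_cellsPowInt : List TPDCell → ℕ → ℚ
  | [], _ => 0
  | c :: cs, q => c.fp.psi.powIntQ (q + 1) + tl_cellsPowInt cs q

/-- An archimedean cell moment is affine in the level. [folklore] -/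
theorem tl_weilCell_momentQ_level (c : WeilCell) (wL wL' : ℚ) (q : ℕ) :
    c.momentQ wL' q = c.momentQ wL q + (wL' - wL) * c.powIntQ (q + 1) := by
  unfold WeilCell.momentQ
  ring

/-- A first-prime cell moment is affine in the level. [folklore] -/
theorem tl_fpdCell_momentQ_level (c : FPDCell) (wL wL' : ℚ) (q : ℕ) :
    c.momentQ wL' q = c.momentQ wL q + (wL' - wL) * c.psi.powIntQ (q + 1) := by
  unfold FPDCell.momentQ
  rw [tl_weilCell_momentQ_level c.psi wL wL' q]
  ring

/-- A two-prime cell moment is affine in the level. [folklore] -/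
theorem tl_tpdCell_momentQ_level (c : TPDCell) (wL wL' : ℚ) (q : ℕ) :
    c.momentQ wL' q = c.momentQ wL q + (wL' - wL) * c.fp.psi.powIntQ (q + 1) := by
  unfold TPDCell.momentQ
  rw [tl_fpdCell_momentQ_level c.fp wL wL' q]
  ring

/-- **The chain moments are affine in the level**:
`cellsMomentQ₂₃ wL' cells q = cellsMomentQ₂₃ wL cells q + (wL' − wL) · tl_cellsPowInt cells q`.
[folklore] -/
theorem tl_cellsMomentQ₂₃_level (cells : List TPDCell) (wL wL' : ℚ) (q : ℕ) :
    cellsMomentQ₂₃ wL' cells q =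
      cellsMomentQ₂₃ wL cells q + (wL' - wL) * tl_cellsPowInt cells q := by
  induction cells with
  | nil => simp [cellsMomentQ₂₃, tl_cellsPowInt]
  | cons c cs ih =>
    simp only [cellsMomentQ₂₃, tl_cellsPowInt]
    rw [tl_tpdCell_momentQ_level c wL wL' q, ih]
    ring

/-- **The power integrals of a chain telescope**: for a chain from `s` to `T`,
`tl_cellsPowInt cells q = (T^{q+1} − s^{q+1})/(q+1)`. [folklore] -/
theorem tl_cellsPowInt_of_chain (q : ℕ) :
    ∀ (cells : List TPDCell) (s T : ℚ), checkChain₂₃ cells s T = true →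
      tl_cellsPowInt cells q = (T ^ (q + 1) - s ^ (q + 1)) / ((q : ℚ) + 1)
  | [], s, T, h => by
    simp only [checkChain₂₃, decide_eq_true_eq] at h
    subst h
    simp [tl_cellsPowInt]
  | c :: cs, s, T, h => by
    simp only [checkChain₂₃, Bool.and_eq_true, decide_eq_true_eq] at h
    obtain ⟨hu, hrest⟩ := h
    simp only [tl_cellsPowInt]
    rw [tl_cellsPowInt_of_chain q cs _ _ hrest, WeilCell.powIntQ, ← hu]
    push_cast
    ring

/-- The power integrals of the landed chain on `[0, 120]`: `120^{q+1}/(q+1)`. [folklore] -/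
theorem tl_cellsPowInt_T120 (q : ℕ) :
    tl_cellsPowInt weilTwoPrimeCellsT120 q = (120 : ℚ) ^ (q + 1) / ((q : ℚ) + 1) := by
  rw [tl_cellsPowInt_of_chain q weilTwoPrimeCellsT120 0 120 checkChain_weilTwoPrimeCellsT120,
    zero_pow (Nat.succ_ne_zero q), sub_zero]

/-! ## The moment check of a certificate at a shifted level -/

/-- **One entry of the moment check at a shifted level, from the landed partial sums.** For a
certificate `c` whose cells are the chain on `[0, 120]` and whose level is ANY `wL'`: if the six
chunk sums AT THE LANDED LEVEL `wL₁₂₀ = weilTwoPrimeCellsT120Level` have the values `v₀, …, v₅`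
(the kernel facts `nuPartT120_i_q_eq` of the tree) and the claimed entry passes
`|ν̃_q − nuScale · a₀^q · 2 (v₀ + ⋯ + v₅ + (wL' − wL₁₂₀) · 120^{q+1}/(q+1))| ≤ 2^{-pnu}`, then
`c.checkNuAt q`. [folklore] -/
theorem tl_checkNuAt_of_partsT120_level (c : WeilCert23) (hcells : c.cells = weilTwoPrimeCellsT120)
    {wL' : ℚ} (hwL : c.base.wL = wL') (q : ℕ) {v₀ v₁ v₂ v₃ v₄ v₅ : ℚ}
    (h₀ : cellsMomentQ₂₃ weilTwoPrimeCellsT120Level weilTwoPrimeCellsT120C0 q = v₀)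
    (h₁ : cellsMomentQ₂₃ weilTwoPrimeCellsT120Level weilTwoPrimeCellsT120C1 q = v₁)
    (h₂ : cellsMomentQ₂₃ weilTwoPrimeCellsT120Level weilTwoPrimeCellsT120C2 q = v₂)
    (h₃ : cellsMomentQ₂₃ weilTwoPrimeCellsT120Level weilTwoPrimeCellsT120C3 q = v₃)
    (h₄ : cellsMomentQ₂₃ weilTwoPrimeCellsT120Level weilTwoPrimeCellsT120C4 q = v₄)
    (h₅ : cellsMomentQ₂₃ weilTwoPrimeCellsT120Level weilTwoPrimeCellsT120C5 q = v₅)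
    (hlit : |getV c.nuData q - nuScale * (c.base.a0 ^ q *
      (2 * (v₀ + v₁ + v₂ + v₃ + v₄ + v₅ +
        (wL' - weilTwoPrimeCellsT120Level) * ((120 : ℚ) ^ (q + 1) / ((q : ℚ) + 1)))))| ≤
      1 / 2 ^ c.pnu) :
    c.checkNuAt q = true := by
  unfold WeilCert23.checkNuAt WeilCert23.nuQ
  rw [decide_eq_true_eq, hcells, hwL,
    tl_cellsMomentQ₂₃_level weilTwoPrimeCellsT120 weilTwoPrimeCellsT120Level wL' q,
    cellsMomentQ₂₃_T120_split, h₀, h₁, h₂, h₃, h₄, h₅, tl_cellsPowInt_T120]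
  exact hlit

/-- The same with the total landed sum named: if `Σᵢ vᵢ = V` (the value the landed certificates
already check against) then the shifted entry is `V + (wL' − wL₁₂₀) · 120^{q+1}/(q+1)`.
[folklore] -/
theorem tl_checkNuAt_of_sumT120_level (c : WeilCert23) (hcells : c.cells = weilTwoPrimeCellsT120)
    {wL' : ℚ} (hwL : c.base.wL = wL') (q : ℕ) {V : ℚ}
    (hV : cellsMomentQ₂₃ weilTwoPrimeCellsT120Level weilTwoPrimeCellsT120 q = V)
    (hlit : |getV c.nuData q - nuScale * (c.base.a0 ^ q *
      (2 * (V + (wL' - weilTwoPrimeCellsT120Level) * ((120 : ℚ) ^ (q + 1) / ((q : ℚ) + 1)))))| ≤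
      1 / 2 ^ c.pnu) :
    c.checkNuAt q = true := by
  unfold WeilCert23.checkNuAt WeilCert23.nuQ
  rw [decide_eq_true_eq, hcells, hwL,
    tl_cellsMomentQ₂₃_level weilTwoPrimeCellsT120 weilTwoPrimeCellsT120Level wL' q, hV,
    tl_cellsPowInt_T120]
  exact hlit

end Summit.RiemannHypothesis.RiemannHypothesis.Theorems.EvenWinsBeyondArch
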